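import Literature.Analysis.Complex.CauchyTransformHolderAux
import Literature.Analysis.Complex.DbarAlongCalculus
import Literature.Analysis.Complex.ApproximateHolomorphy
import HarnessLib

/-!
# A priori Hölder estimates for the Cauchy transform: the interior estimate

Topic `Literature/Analysis/Complex`. For a smooth density `g` supported in the disc `B(0, ρ)`,
with `‖g‖ ≤ K₀` and `r`-Hölder constant `K₁` (`0 < r < 1`), the derivative of the Cauchy
transform `T g` is `r`-Hölder on the disc `B(0, 6ρ)` with constant `C(ρ, r) (K₀ + K₁)`
(`holder_fderiv_cauchyTransform_interior`). This is the heart of Vekua's theorem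
`T : C^{0,r}_c → C^{1,r}` (I. N. Vekua, *Generalized analytic functions* (1962), Thm. 1.32),
proved here by potential theory with the tree's constant-coefficient Schauder estimate
(`Literature.Analysis.FunctionSpaces.exists_schauder_const_laplacian_direction`,
Gilbarg–Trudinger Thm. 4.8) instead of Calderón–Zygmund theory:

with a cut-off `χ = 1` on `B̄(0, 6ρ)`, `k = χ • T g` and the *conjugate* Cauchy transform
`V = T (k ∘ conj)`, one has `∂̄ V = k ∘ conj`, hence `Δ V = 4 ∂ ∂̄ V = 4 (∂̄ k) ∘ conj =
4 ((∂̄χ) • T g + g) ∘ conj`, whose Hölder seminorm is `≲ K₀ + K₁` (`T g` is holomorphic with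
Cauchy estimates where `∂̄χ ≠ 0`); the Schauder estimate bounds `[D² V]_r`, and
`D(T g) = D k = D(∂̄ V ∘ conj)` on `B(0, 6ρ)`.

## References

* I. N. Vekua, *Generalized analytic functions* (1962), Thm. 1.32.
* D. Gilbarg, N. S. Trudinger, *Elliptic Partial Differential Equations of Second Order* (2001),
  Thm. 4.8. [GilbargTrudinger2001]
* L. Hörmander, *An Introduction to Complex Analysis in Several Variables* (1973), Thm. 1.2.2.
  [HormanderSCV1973]
-/

noncomputable section

open scoped ContDiff Topology Real NNReal Laplacian ComplexConjugate
open Set Metric MeasureTheory Filter Complex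

namespace Literature.Analysis.Complex

variable {F : Type*} [NormedAddCommGroup F] [NormedSpace ℂ F]

/-! ### Calculus through complex conjugation -/

/-- Chain rule through complex conjugation: `D(f ∘ conj)(z) = Df(conj z) ∘ conj`. [folklore] -/
theorem fderiv_comp_conj (f : ℂ → F) (z : ℂ) :
    fderiv ℝ (fun w => f (conj w)) z = (fderiv ℝ f (conj z)).comp (conjCLE : ℂ →L[ℝ] ℂ) := by
  have e : (fun w => f (conj w)) = f ∘ ⇑conjCLE := rfl
  rw [e, conjCLE.comp_right_fderiv]
  rfl

/-- Chain rule through complex conjugation, applied form: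
`D(f ∘ conj)(z)[v] = Df(conj z)[conj v]`. [folklore] -/
theorem fderiv_comp_conj_apply (f : ℂ → F) (z v : ℂ) :
    fderiv ℝ (fun w => f (conj w)) z v = fderiv ℝ f (conj z) (conj v) := by
  rw [fderiv_comp_conj]
  rfl

/-- **`∂ (k ∘ conj) = (∂̄ k) ∘ conj`**: `D(k ∘ conj)(y)[1] - i D(k ∘ conj)(y)[i] = 2 ∂̄k(conj y)`.
[folklore] -/
theorem fderiv_comp_conj_one_sub (k : ℂ → F) (y : ℂ) :
    fderiv ℝ (fun w => k (conj w)) y 1 - I • fderiv ℝ (fun w => k (conj w)) y I =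
      (2 : ℂ) • dbarAlong 1 k (conj y) := by
  rw [fderiv_comp_conj_apply, fderiv_comp_conj_apply, map_one, conj_I, map_neg, smul_neg,
    sub_neg_eq_add, dbarAlong_one, smul_smul]
  norm_num

/-! ### The Laplacian through `∂̄` -/

/-- **`Δ = 4 ∂ ∂̄` on `C²` functions**: `Δ V(y) = 2 (D(∂̄V)(y)[1] - i D(∂̄V)(y)[i])`
(symmetry of the second derivative). [folklore] -/
theorem laplacian_eq_two_smul_fderiv_dbarAlong {V : ℂ → F} (hV : ContDiff ℝ 2 V) (y : ℂ) :
    Δ V y = (2 : ℂ) • (fderiv ℝ (dbarAlong 1 V) y 1 - I • fderiv ℝ (dbarAlong 1 V) y I) := by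
  have hs : IsSymmSndFDerivAt ℝ V y := hV.contDiffAt.isSymmSndFDerivAt (by simp)
  rw [InnerProductSpace.laplacian_eq_iteratedFDeriv_complexPlane]
  simp only [iteratedFDeriv_two_apply, Matrix.cons_val_zero, Matrix.cons_val_one,
    Matrix.cons_val_fin_one]
  rw [fderiv_dbarAlong_apply hV.contDiffAt le_rfl, fderiv_dbarAlong_apply hV.contDiffAt le_rfl,
    smul_eq_mul, mul_one, hs I 1]
  simp only [smul_add, smul_sub, smul_smul]
  match_scalars <;> first | ring1 | linear_combination I_sq

/-- **The Laplacian of a `C²` function `V` with `∂̄ V = k ∘ conj`** is `Δ V = 4 (∂̄ k) ∘ conj`.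
[folklore] -/
theorem laplacian_eq_four_smul_dbarAlong_conj {V k : ℂ → F} (hV : ContDiff ℝ 2 V)
    (hVk : dbarAlong 1 V = fun w => k (conj w)) (y : ℂ) :
    Δ V y = (4 : ℂ) • dbarAlong 1 k (conj y) := by
  rw [laplacian_eq_two_smul_fderiv_dbarAlong hV, hVk, fderiv_comp_conj_one_sub, smul_smul]
  norm_num

/-- Algebra of `∂̄`-type expressions: `½(A + iB) - ½(A' + iB') = ½((A - A') + i(B - B'))`.
[folklore] -/
theorem half_smul_sub_half_smul (A A' B B' : F) :
    (2 : ℂ)⁻¹ • (A + I • B) - (2 : ℂ)⁻¹ • (A' + I • B') =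
      (2 : ℂ)⁻¹ • ((A - A') + I • (B - B')) := by
  module

/-- `‖½ (X + i Y)‖ ≤ ½ (‖X‖ + ‖Y‖)`. [folklore] -/
theorem norm_half_smul_add_I_smul_le (X Y : F) :
    ‖(2 : ℂ)⁻¹ • (X + I • Y)‖ ≤ 2⁻¹ * (‖X‖ + ‖Y‖) := by
  rw [norm_smul, norm_inv, Complex.norm_two]
  gcongr
  calc ‖X + I • Y‖ ≤ ‖X‖ + ‖I • Y‖ := norm_add_le _ _
    _ = ‖X‖ + ‖Y‖ := by rw [norm_smul, Complex.norm_I, one_mul]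

/-- **From `[D²V]` to `[D ∂̄V]`**: if the four second derivatives `D²V(a, b)`, `a, b ∈ {1, i}`,
differ by at most `B` between `y` and `y'`, then `‖D(∂̄V)(y) - D(∂̄V)(y')‖ ≤ 2B`. [folklore] -/
theorem norm_fderiv_dbarAlong_sub_le {V : ℂ → F} (hV : ContDiff ℝ 2 V) {B : ℝ} {y y' : ℂ}
    (h : ∀ a b : ℂ, (a = 1 ∨ a = I) → (b = 1 ∨ b = I) →
      ‖fderiv ℝ (fderiv ℝ V) y a b - fderiv ℝ (fderiv ℝ V) y' a b‖ ≤ B) :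
    ‖fderiv ℝ (dbarAlong 1 V) y - fderiv ℝ (dbarAlong 1 V) y'‖ ≤ 2 * B := by
  have key : ∀ a : ℂ, (a = 1 ∨ a = I) →
      ‖(fderiv ℝ (dbarAlong 1 V) y - fderiv ℝ (dbarAlong 1 V) y') a‖ ≤ B := by
    intro a ha
    rw [_root_.sub_apply, fderiv_dbarAlong_apply hV.contDiffAt le_rfl,
      fderiv_dbarAlong_apply hV.contDiffAt le_rfl, smul_eq_mul, mul_one, half_smul_sub_half_smul]
    refine (norm_half_smul_add_I_smul_le _ _).trans ?_
    have h1 := h a 1 ha (Or.inl rfl)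
    have h2 := h a I ha (Or.inr rfl)
    linarith
  calc ‖fderiv ℝ (dbarAlong 1 V) y - fderiv ℝ (dbarAlong 1 V) y'‖
        ≤ ‖(fderiv ℝ (dbarAlong 1 V) y - fderiv ℝ (dbarAlong 1 V) y') 1‖ +
          ‖(fderiv ℝ (dbarAlong 1 V) y - fderiv ℝ (dbarAlong 1 V) y') I‖ :=
        opNorm_le_norm_apply_one_add _
    _ ≤ B + B := add_le_add (key 1 (Or.inl rfl)) (key I (Or.inr rfl))
    _ = 2 * B := by ring

/-! ### The Hölder bound for the cut-off error term -/

/-- **Hölder bound for `ψ • G` with `ψ` supported in the exterior region.** If `ψ` is bounded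
by `S`, `L`-Lipschitz and vanishes on `B(0, 4ρ)`, while `‖G‖ ≤ 6 ρ K₀` and `G` is
`12 K₀`-Lipschitz on the discs `B(z', ρ)`, `‖z'‖ ≥ 4ρ`, then `ψ • G` is `r`-Hölder with constant
`(24 S + 6 L ρ) ρ^{1-r} K₀`. [folklore] -/
theorem norm_smul_sub_smul_le_of_exterior {ψ : ℂ → ℂ} {G : ℂ → F} {ρ K₀ S L r : ℝ}
    (hρ : 0 < ρ) (hK₀ : 0 ≤ K₀) (hS : 0 ≤ S) (hL : 0 ≤ L) (hr0 : 0 ≤ r) (hr1 : r ≤ 1)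
    (hψ0 : ∀ z, ψ z ≠ 0 → 4 * ρ ≤ ‖z‖) (hψb : ∀ z, ‖ψ z‖ ≤ S)
    (hψL : ∀ z z', ‖ψ z - ψ z'‖ ≤ L * ‖z - z'‖) (hGb : ∀ z, ‖G z‖ ≤ 6 * ρ * K₀)
    (hGL : ∀ z z', 4 * ρ ≤ ‖z'‖ → ‖z - z'‖ < ρ → ‖G z - G z'‖ ≤ 12 * K₀ * ‖z - z'‖)
    (z z' : ℂ) :
    ‖ψ z • G z - ψ z' • G z'‖ ≤ (24 * S + 6 * L * ρ) * ρ ^ (1 - r) * K₀ * ‖z - z'‖ ^ r := by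
  -- near field, when `ψ z' ≠ 0`
  have near : ∀ z z', ‖z - z'‖ < ρ → ψ z' ≠ 0 →
      ‖ψ z • G z - ψ z' • G z'‖ ≤ (24 * S + 6 * L * ρ) * ρ ^ (1 - r) * K₀ * ‖z - z'‖ ^ r := by
    intro z z' hlt hz'
    have h2 : ‖z - z'‖ ≤ ρ ^ (1 - r) * ‖z - z'‖ ^ r := by
      have hmin := min_le_rpow_mul_rpow (norm_nonneg (z - z')) hρ hr0 hr1
      rwa [min_eq_left hlt.le] at hmin
    have hG := hGL z z' (hψ0 z' hz') hlt
    calc ‖ψ z • G z - ψ z' • G z'‖ = ‖(ψ z - ψ z') • G z + ψ z' • (G z - G z')‖ := by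
          congr 1
          module
      _ ≤ ‖ψ z - ψ z'‖ * ‖G z‖ + ‖ψ z'‖ * ‖G z - G z'‖ := by
          refine (norm_add_le _ _).trans ?_
          rw [norm_smul, norm_smul]
      _ ≤ L * ‖z - z'‖ * (6 * ρ * K₀) + S * (12 * K₀ * ‖z - z'‖) := by
          gcongr
          · exact hψL z z'
          · exact hGb z
          · exact hψb z'
      _ = (12 * S + 6 * L * ρ) * K₀ * ‖z - z'‖ := by ring
      _ ≤ (12 * S + 6 * L * ρ) * K₀ * (ρ ^ (1 - r) * ‖z - z'‖ ^ r) :=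
          mul_le_mul_of_nonneg_left h2 (by positivity)
      _ ≤ (24 * S + 6 * L * ρ) * ρ ^ (1 - r) * K₀ * ‖z - z'‖ ^ r := by
          have : 0 ≤ 12 * S * ρ ^ (1 - r) * K₀ * ‖z - z'‖ ^ r := by positivity
          nlinarith
  by_cases hfar : ρ ≤ ‖z - z'‖
  · -- far field: the trivial bound
    have h2 : ρ ≤ ρ ^ (1 - r) * ‖z - z'‖ ^ r := by
      have hmin := min_le_rpow_mul_rpow (norm_nonneg (z - z')) hρ hr0 hr1
      rwa [min_eq_right hfar] at hmin
    calc ‖ψ z • G z - ψ z' • G z'‖ ≤ ‖ψ z • G z‖ + ‖ψ z' • G z'‖ := norm_sub_le _ _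
      _ ≤ S * (6 * ρ * K₀) + S * (6 * ρ * K₀) := by
          rw [norm_smul, norm_smul]
          gcongr
          · exact hψb z
          · exact hGb z
          · exact hψb z'
          · exact hGb z'
      _ = 12 * S * K₀ * ρ := by ring
      _ ≤ 12 * S * K₀ * (ρ ^ (1 - r) * ‖z - z'‖ ^ r) :=
          mul_le_mul_of_nonneg_left h2 (by positivity)
      _ ≤ (24 * S + 6 * L * ρ) * ρ ^ (1 - r) * K₀ * ‖z - z'‖ ^ r := by
          have h₁ : 0 ≤ 12 * S * ρ ^ (1 - r) * K₀ * ‖z - z'‖ ^ r := by positivity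
          have h₂ : 0 ≤ 6 * L * ρ * ρ ^ (1 - r) * K₀ * ‖z - z'‖ ^ r := by positivity
          nlinarith
  · have hlt : ‖z - z'‖ < ρ := lt_of_not_ge hfar
    by_cases hz' : ψ z' = 0
    · by_cases hz : ψ z = 0
      · rw [hz, hz', zero_smul, zero_smul, sub_zero, norm_zero]
        positivity
      · have h := near z' z (by rwa [norm_sub_rev]) hz
        rwa [norm_sub_rev, norm_sub_rev z'] at h
    · exact near z z' hlt hz'

/-! ### The interior estimate -/

section Interior

variable [CompleteSpace F]

/-- **Interior a priori Hölder estimate for `D(T g)`.** For `0 < r < 1` and `ρ > 0` there is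
`C = C(r, ρ) ≥ 0` such that for every smooth `g` vanishing on `{ρ ≤ ‖z‖}` with `‖g‖ ≤ K₀` and
`‖g z - g z'‖ ≤ K₁ ‖z - z'‖ ^ r`, the derivative of `T g` satisfies
`‖D(T g)(z) - D(T g)(z')‖ ≤ C (K₀ + K₁) ‖z - z'‖ ^ r` for `z, z' ∈ B(0, 6ρ)` (Vekua (1962),
Thm. 1.32, interior part; here via `Δ (T(k ∘ conj)) = 4 (∂̄k) ∘ conj`, `k = χ • T g`, and the
Schauder estimate for `Δ`). [folklore] -/
theorem holder_fderiv_cauchyTransform_interior {r : ℝ≥0} (hr : 0 < r) (hr1 : r < 1) {ρ : ℝ}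
    (hρ : 0 < ρ) :
    ∃ C : ℝ, 0 ≤ C ∧ ∀ g : ℂ → F, ContDiff ℝ ∞ g → (∀ z, ρ ≤ ‖z‖ → g z = 0) →
      ∀ K₀ K₁ : ℝ, 0 ≤ K₀ → 0 ≤ K₁ → (∀ z, ‖g z‖ ≤ K₀) →
        (∀ z z', ‖g z - g z'‖ ≤ K₁ * ‖z - z'‖ ^ (r : ℝ)) →
        ∀ z z', ‖z‖ < 6 * ρ → ‖z'‖ < 6 * ρ →
          ‖fderiv ℝ (cauchyTransformAlong 1 g) z - fderiv ℝ (cauchyTransformAlong 1 g) z'‖ ≤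
            C * (K₀ + K₁) * ‖z - z'‖ ^ (r : ℝ) := by
  have hr0 : (0 : ℝ) ≤ r := r.coe_nonneg
  have hr1' : (r : ℝ) ≤ 1 := by exact_mod_cast hr1.le
  -- the cut-off `χ` (`= 1` on `B̄(0, 6ρ)`, supported in `B(0, 7ρ)`) and `ψ = ∂̄χ`
  obtain ⟨χ, hχs, hχc, hχ1, hχ0, hχb⟩ :=
    Similarity.exists_cutoff (ρm := 6 * ρ) (ρ := 7 * ρ) (by positivity) (by linarith)
  have hχ1s : ContDiff ℝ 1 χ := hχs.of_le (by exact_mod_cast le_top)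
  have hχ2s : ContDiff ℝ 2 χ := contDiff_infty.1 hχs 2
  set ψ : ℂ → ℂ := dbarAlong 1 χ with hψdef
  have hψs : ContDiff ℝ 1 ψ := (contDiff_infty_dbarAlong hχs 1).of_le (by exact_mod_cast le_top)
  have hψc : HasCompactSupport ψ := hasCompactSupport_dbarAlong hχc 1
  obtain ⟨S₀, hS₀⟩ := hψs.continuous.bounded_above_of_compact_support hψc
  obtain ⟨L₀, hL₀⟩ :=
    (hψs.continuous_fderiv one_ne_zero).bounded_above_of_compact_support (hψc.fderiv ℝ)
  set S : ℝ := max S₀ 0 with hSdef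
  set L : ℝ := max L₀ 0 with hLdef
  have hS : 0 ≤ S := le_max_right _ _
  have hL : 0 ≤ L := le_max_right _ _
  have hψb : ∀ z, ‖ψ z‖ ≤ S := fun z => (hS₀ z).trans (le_max_left _ _)
  have hψL : ∀ z z', ‖ψ z - ψ z'‖ ≤ L * ‖z - z'‖ := fun z z' =>
    (convex_univ (𝕜 := ℝ) (E := ℂ)).norm_image_sub_le_of_norm_fderiv_le
      (fun x _ => hψs.differentiable one_ne_zero x) (fun x _ => (hL₀ x).trans (le_max_left _ _))
      (mem_univ z') (mem_univ z)
  have hψ0 : ∀ z, ψ z ≠ 0 → 4 * ρ ≤ ‖z‖ := by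
    intro z hz
    by_contra hlt
    apply hz
    have hconst : χ =ᶠ[𝓝 z] fun _ => (1 : ℂ) := by
      filter_upwards [isOpen_ball.mem_nhds
        (show z ∈ ball (0 : ℂ) (6 * ρ) by rw [mem_ball_zero_iff]; linarith [not_le.1 hlt])]
        with w hw
      exact hχ1 w (mem_ball_zero_iff.1 hw).le
    rw [hψdef, dbarAlong_congr_of_eventuallyEq hconst]
    simp [dbarAlong_apply]
  -- the Schauder constants in the four coordinate directions
  obtain ⟨C₁₁, hC₁₁, h₁₁⟩ := schauder_laplacian_direction_real (F := F) hr hr1 1 1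
  obtain ⟨C₁₂, hC₁₂, h₁₂⟩ := schauder_laplacian_direction_real (F := F) hr hr1 1 I
  obtain ⟨C₂₁, hC₂₁, h₂₁⟩ := schauder_laplacian_direction_real (F := F) hr hr1 I 1
  obtain ⟨C₂₂, hC₂₂, h₂₂⟩ := schauder_laplacian_direction_real (F := F) hr hr1 I I
  set CS : ℝ := C₁₁ + C₁₂ + C₂₁ + C₂₂ with hCS
  set A : ℝ := (24 * S + 6 * L * ρ) * ρ ^ (1 - (r : ℝ)) with hA
  have hA0 : 0 ≤ A := by positivity
  refine ⟨2 * CS * (252 * ρ ^ 2 + 4 * A + 4), by positivity, ?_⟩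
  intro g hg hg0 K₀ K₁ hK₀ hK₁ hgb hgH z z' hz hz'
  -- Step 1: `G = T g`
  have hgc : HasCompactSupport g := hasCompactSupport_of_eq_zero_of_le_norm hg0
  have hg2 : ContDiff ℝ 2 g := contDiff_infty.1 hg 2
  have hg1 : ContDiff ℝ 1 g := hg.of_le (by exact_mod_cast le_top)
  have hsupp := norm_lt_of_ne_zero_of_eq_zero_of_le_norm hg0
  set G : ℂ → F := cauchyTransformAlong 1 g with hGdef
  have hGs : ContDiff ℝ 2 G := contDiff_cauchyTransformAlong hg2 hgc one_ne_zero
  have hGb : ∀ w, ‖G w‖ ≤ 6 * ρ * K₀ := norm_cauchyTransform_le_uniform hρ.le hK₀ hsupp hgb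
  have hGg : ∀ w, dbarAlong 1 G w = g w := dbarAlong_cauchyTransformAlong hg1 hgc one_ne_zero
  have hGL : ∀ w w', 4 * ρ ≤ ‖w'‖ → ‖w - w'‖ < ρ → ‖G w - G w'‖ ≤ 12 * K₀ * ‖w - w'‖ :=
    fun w w' hw' hww' =>
      norm_cauchyTransform_sub_le_exterior hg.continuous hρ hK₀ hg0 hgb hw' hww'
  -- Step 2: `k = χ • G` and `k' = k ∘ conj`
  set k : ℂ → F := fun w => χ w • G w with hkdef
  set k' : ℂ → F := fun w => k (conj w) with hk'def
  have hks : ContDiff ℝ 2 k := hχ2s.smul hGs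
  have hk0 : ∀ w, 7 * ρ ≤ ‖w‖ → k w = 0 := fun w hw => by
    have h : χ w = 0 := by
      by_contra h
      exact absurd (hχ0 w h) (not_lt.2 hw)
    simp [hkdef, h]
  have hk'0 : ∀ w, 7 * ρ ≤ ‖w‖ → k' w = 0 := fun w hw => hk0 (conj w) (by rwa [norm_conj])
  have hk's : ContDiff ℝ 2 k' := hks.comp conjCLE.contDiff
  have hk'1 : ContDiff ℝ 1 k' := hk's.of_le (by norm_num)
  have hk'c : HasCompactSupport k' := hasCompactSupport_of_eq_zero_of_le_norm hk'0
  have hkb : ∀ w, ‖k w‖ ≤ 6 * ρ * K₀ := fun w => by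
    simp only [hkdef, norm_smul]
    calc ‖χ w‖ * ‖G w‖ ≤ 1 * (6 * ρ * K₀) :=
          mul_le_mul (hχb w) (hGb w) (norm_nonneg _) zero_le_one
      _ = 6 * ρ * K₀ := one_mul _
  have hk'b : ∀ w, ‖k' w‖ ≤ 6 * ρ * K₀ := fun w => hkb (conj w)
  -- Step 3: `V = T k'`, with `∂̄ V = k'`
  set V : ℂ → F := cauchyTransformAlong 1 k' with hVdef
  have hVs : ContDiff ℝ 2 V := contDiff_cauchyTransformAlong hk's hk'c one_ne_zero
  have hVb : ∀ y, ‖V y‖ ≤ 6 * (7 * ρ) * (6 * ρ * K₀) :=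
    norm_cauchyTransform_le_uniform (by positivity) (by positivity)
      (norm_lt_of_ne_zero_of_eq_zero_of_le_norm hk'0) hk'b
  obtain ⟨M₁, M₂, hM₁, hM₂⟩ := exists_fderiv_bounds_cauchyTransform hk's hk'c
  have hVk : dbarAlong 1 V = k' := funext (dbarAlong_cauchyTransformAlong hk'1 hk'c one_ne_zero)
  -- Step 4: `Δ V = 4 (∂̄ k) ∘ conj = 4 (ψ • G + g) ∘ conj`
  have hdk : ∀ w, dbarAlong 1 k w = ψ w • G w + g w := by
    intro w
    have hχd : DifferentiableAt ℝ χ w := hχ1s.differentiable one_ne_zero w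
    have hGd : DifferentiableAt ℝ G w := hGs.differentiable (by norm_num) w
    rw [hkdef, dbarAlong_smul hχd hGd, hGg]
    congr 1
    by_cases hgw : g w = 0
    · rw [hgw, smul_zero]
    · rw [hχ1 w (by linarith [hsupp w hgw]), one_smul]
  have hΔ : ∀ y, Δ V y = (4 : ℂ) • (ψ (conj y) • G (conj y) + g (conj y)) := fun y => by
    rw [laplacian_eq_four_smul_dbarAlong_conj hVs hVk, hdk]
  -- Step 5: the Hölder bound for `Δ V`
  have hψG := norm_smul_sub_smul_le_of_exterior hρ hK₀ hS hL hr0 hr1' hψ0 hψb hψL hGb hGL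
  have hΔH : ∀ y y', ‖Δ V y - Δ V y'‖ ≤ 4 * (A * K₀ + K₁) * ‖y - y'‖ ^ (r : ℝ) := by
    intro y y'
    have hd : ‖conj y - conj y'‖ = ‖y - y'‖ := by rw [← map_sub, norm_conj]
    have e : ψ (conj y) • G (conj y) + g (conj y) - (ψ (conj y') • G (conj y') + g (conj y')) =
        (ψ (conj y) • G (conj y) - ψ (conj y') • G (conj y')) + (g (conj y) - g (conj y')) := by
      abel
    rw [hΔ, hΔ, ← smul_sub, norm_smul, e]
    have h4 : ‖(4 : ℂ)‖ = 4 := Complex.norm_ofNat 4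
    rw [h4]
    calc 4 * ‖(ψ (conj y) • G (conj y) - ψ (conj y') • G (conj y')) + (g (conj y) - g (conj y'))‖
        ≤ 4 * (A * K₀ * ‖conj y - conj y'‖ ^ (r : ℝ) + K₁ * ‖conj y - conj y'‖ ^ (r : ℝ)) := by
          gcongr
          exact (norm_add_le _ _).trans (add_le_add (hψG _ _) (hgH _ _))
      _ = 4 * (A * K₀ + K₁) * ‖y - y'‖ ^ (r : ℝ) := by rw [hd]; ring
  -- Step 6: the Schauder estimate for `V` in the four coordinate directions
  set M₀ : ℝ := 6 * (7 * ρ) * (6 * ρ * K₀) with hM₀def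
  set Lr : ℝ := 4 * (A * K₀ + K₁) with hLrdef
  have hM₀ : 0 ≤ M₀ := by positivity
  have hLr : 0 ≤ Lr := by positivity
  have hdn : ∀ y y' : ℂ, 0 ≤ (M₀ + Lr) * ‖y - y'‖ ^ (r : ℝ) := fun y y' => by positivity
  have hB : ∀ a b : ℂ, (a = 1 ∨ a = I) → (b = 1 ∨ b = I) → ∀ y y',
      ‖fderiv ℝ (fderiv ℝ V) y a b - fderiv ℝ (fderiv ℝ V) y' a b‖ ≤
        CS * (M₀ + Lr) * ‖y - y'‖ ^ (r : ℝ) := by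
    intro a b ha hb y y'
    have hw : ∀ {C : ℝ}, C ≤ CS →
        ‖fderiv ℝ (fderiv ℝ V) y a b - fderiv ℝ (fderiv ℝ V) y' a b‖ ≤
          C * (M₀ + Lr) * ‖y - y'‖ ^ (r : ℝ) →
        ‖fderiv ℝ (fderiv ℝ V) y a b - fderiv ℝ (fderiv ℝ V) y' a b‖ ≤
          CS * (M₀ + Lr) * ‖y - y'‖ ^ (r : ℝ) := fun hC h =>
      h.trans (by rw [mul_assoc, mul_assoc]; exact mul_le_mul_of_nonneg_right hC (hdn y y'))
    rcases ha with rfl | rfl <;> rcases hb with rfl | rfl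
    · exact hw (by linarith) (h₁₁ V M₀ M₁ M₂ Lr hM₀ hLr hVs hVb hM₁ hM₂ hΔH y y')
    · exact hw (by linarith) (h₁₂ V M₀ M₁ M₂ Lr hM₀ hLr hVs hVb hM₁ hM₂ hΔH y y')
    · exact hw (by linarith) (h₂₁ V M₀ M₁ M₂ Lr hM₀ hLr hVs hVb hM₁ hM₂ hΔH y y')
    · exact hw (by linarith) (h₂₂ V M₀ M₁ M₂ Lr hM₀ hLr hVs hVb hM₁ hM₂ hΔH y y')
  -- Step 7: the Hölder bound for `D k' = D(∂̄ V)`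
  have hDk' : ∀ y y', ‖fderiv ℝ k' y - fderiv ℝ k' y'‖ ≤
      2 * (CS * (M₀ + Lr) * ‖y - y'‖ ^ (r : ℝ)) := by
    intro y y'
    rw [← hVk]
    exact norm_fderiv_dbarAlong_sub_le hVs fun a b ha hb => hB a b ha hb y y'
  -- Step 8: back to `D G = D k = D(k' ∘ conj)` on `B(0, 6ρ)`
  have hGk : ∀ w, ‖w‖ < 6 * ρ →
      fderiv ℝ G w = (fderiv ℝ k' (conj w)).comp (conjCLE : ℂ →L[ℝ] ℂ) := by
    intro w hw
    have hloc : k =ᶠ[𝓝 w] G := by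
      filter_upwards [isOpen_ball.mem_nhds (mem_ball_zero_iff.2 hw)] with u hu
      rw [mem_ball_zero_iff] at hu
      show χ u • G u = G u
      rw [hχ1 u hu.le, one_smul]
    have hkk' : k = fun u => k' (conj u) := by
      funext u
      simp [hk'def]
    rw [← hloc.fderiv_eq, hkk', fderiv_comp_conj]
  rw [hGk z hz, hGk z' hz', ← ContinuousLinearMap.sub_comp]
  refine (ContinuousLinearMap.opNorm_comp_le _ _).trans ?_
  rw [conjCLE_norm, mul_one]
  refine (hDk' (conj z) (conj z')).trans ?_
  rw [← map_sub, norm_conj]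
  have hML : M₀ + Lr ≤ (252 * ρ ^ 2 + 4 * A + 4) * (K₀ + K₁) := by
    rw [hM₀def, hLrdef]
    nlinarith [mul_nonneg (sq_nonneg ρ) hK₁, mul_nonneg hA0 hK₁]
  have hCS0 : 0 ≤ CS := by positivity
  calc 2 * (CS * (M₀ + Lr) * ‖z - z'‖ ^ (r : ℝ)) = 2 * CS * (M₀ + Lr) * ‖z - z'‖ ^ (r : ℝ) := by
        ring
    _ ≤ 2 * CS * ((252 * ρ ^ 2 + 4 * A + 4) * (K₀ + K₁)) * ‖z - z'‖ ^ (r : ℝ) := by gcongr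
    _ = 2 * CS * (252 * ρ ^ 2 + 4 * A + 4) * (K₀ + K₁) * ‖z - z'‖ ^ (r : ℝ) := by ring

end Interior

end Literature.Analysis.Complex
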